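import Summits.BirchSwinnertonDyer.BirchSwinnertonDyer.Theses.PrintCFram
import Summits.BirchSwinnertonDyer.Rank1Residual.PrintCfram.RegimeSplitThree
import Summits.BirchSwinnertonDyer.Rank1Residual.X12.O11.RamifiedStrictDescentAtThreeRegimeVDischarge
import HarnessLib

/-!
# Route `PrintCFram`, regime V `SplitPlaceTorsionBSDThree` (item stmt-BirchSwinnertonDyer-20700) — and
# regime N again — BY NAME from the ONE defect-corrected residual (R-EU)₃ᵛ
# (cell `bsd-print-cfram`, D-0131 (2) print tier, seat ty2 gen 2 = the cell's discharge-interface typer;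
# PLAN v3 §2 ty2 (γ′) «consumer ⟹ SplitPlaceTorsionBSDThree on the frame»)

HONEST FRAMING (cell `bsd-print-cfram`, HOME `run/shared/lean/pub/bsd-print-cfram/`): THEOREMS ONLY
(no definition, no named fact, no axiom, no `sorry`); nothing about BSD is booked; regimes N, V and
the leaf `Summit.BirchSwinnertonDyer.WAllCornerFRamifiedAtThree` stay OPEN; 0 cells move;
beyond-print theorem: NO. `Theorems/` is prover-only for a literature-prover seat, so this file sits
in the cell's `Rank1Residual/PrintCfram/` folder (like `RegimeSplitThree`, `TorsionFreeFrameThree`).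

CONTENT. The defect-corrected elliptic-unit index law at `3`,
`X12.O11.RamifiedCMEllipticUnitIndexAtThreeV W` ((R-EU)₃ᵛ; companion VI, ty2 gen 2: gen 1's (R-EU)₃
with the degree-one away input demanded only off a finite `T₀` and the right side corrected by the
DISPLAYED control defect `log₃ d(T₀)`, `d = X12.O11.controlDefectAtThree`), demanded at every globally
minimal CM curve of analytic rank one with `3` ramified in the CM field, gives — with the four refereed
facts as antecedents, exactly as the items are filed —
* §1 `splitPlaceTorsionBSDThree_of_indexLawAtThreeV` : **regime V** `Theses.PrintCFram.SplitPlaceTorsionBSDThree`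
  BY NAME (the item's last binder, the witness of a bad degree-one place with `K_v`-rational
  `3`-torsion, is not even used: the consumer `X12.O11.bsdp_three_of_indexLawAtThreeV_of_isFrameThree`
  works at every rank-one `3`-frame with (A𝔭)₃, taking `T₀ = Σ(N⁺)`);
* §1 `torsionFreeFrameBSDThree_of_indexLawAtThreeV` : **regime N** `Theses.PrintCFram.TorsionFreeFrameBSDThree`
  BY NAME from the same law (its (Av)₃ binder unused) — so ONE typed residual serves N ∪ V;
* §1 `torsionFree_and_splitPlace_of_indexLawAtThreeV` : both at once.
So after this file the `@3` crux C1 reads, BY NAME: C1 ⟸ N ∧ T ∧ V (glue, p547523) ⟸ (R-EU)₃ᵛ-law ∧ T.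
Nothing is asserted about (R-EU)₃ᵛ (CONSTRUCTION / OPEN: Perrin-Riou's leading-term law for the CM
zeta element at the ramified prime `3`, defect-corrected; not in print).

References: route file `Theses/PrintCFram.lean` rev ≥ 12 (items 20698, 20700); companions V–VI
(`X12/O11/RamifiedStrictDescentAtThree{Defect,RegimeV,RegimeVDischarge}.lean`); HOME/PLAN.md v3 §1c(V),
§2 ty2; HOME/DOSSIER.md §32, §35; [cite: Miller2011LMS, §1 and Def. 1.1 (arXiv:1010.2431 p. 3) (`BSDp`)];
[cite: GreenbergLNM1716, §3 Lemma 3.3, p. 90 and §4 Prop. 4.13 (control and its defect)];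
[cite: GrossZagier1986, Thm. I.(7.3)]; [cite: Cassels1965ArithmeticVIII].
-/

set_option autoImplicit false

noncomputable section

open scoped Classical

open WeierstrassCurve NumberField IsDedekindDomain Field
  Literature.NumberTheory.EllipticCurves
  Literature.NumberTheory.EllipticCurves.Rank1Residual
  Literature.NumberTheory.GaloisRepresentations
  Summit.BirchSwinnertonDyer.Rank1Residual
  Summit.BirchSwinnertonDyer.Rank1Residual.X12.O11
  Summit.BirchSwinnertonDyer.BirchSwinnertonDyer.Theorems
  Summit.BirchSwinnertonDyer.BirchSwinnertonDyer.Theses.PrintCFram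

namespace Summit.BirchSwinnertonDyer.Rank1Residual.PrintCfram

/-! ## §1 Regimes V and N BY NAME from the defect-corrected index law -/

/-- **Regime V ⟸ the class-wide defect-corrected elliptic-unit index law at `3`.** If (R-EU)₃ᵛ holds
at every globally minimal CM curve of analytic rank one with `3` ramified in its CM field, then the
route declaration `Theses.PrintCFram.SplitPlaceTorsionBSDThree` (item stmt-BirchSwinnertonDyer-20700)
holds: at a frame, `W.HasCM` and `CMRamified W 3` are `hF.1`, `hF.2.1`, the two `ℚ₃`-binders are the
item's, and companion VI-b's `bsdp_three_of_indexLawAtThreeV_of_isFrameThree` (with `T₀ = Σ(N⁺)`,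
frame data for the GIVEN frame, (R-ctrl)₃ᵛ♯ a theorem, (R-tors)₃ᵛ ⟸ GZK) gives `BSDp W 3`; the item's
V-witness binder is not used. CONDITIONAL on `hEV`; the type of the conclusion is literally the route
declaration. [cite: Miller2011LMS, §1 and Def. 1.1 (arXiv:1010.2431 p. 3)] -/
theorem splitPlaceTorsionBSDThree_of_indexLawAtThreeV
    (hEV : ∀ (W : WeierstrassCurve ℚ) [W.IsElliptic] [W.IsGloballyMinimal],
      W.HasCM → W.analyticRank = 1 → CMRamified W 3 → RamifiedCMEllipticUnitIndexAtThreeV W) :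
    Summit.BirchSwinnertonDyer.BirchSwinnertonDyer.Theses.PrintCFram.SplitPlaceTorsionBSDThree :=
  fun hmod hGZ hGZK hCassels W _ _ _K _ _ _𝔭 _W' _ _ _C hF hr htors htors' _ =>
    bsdp_three_of_indexLawAtThreeV_of_isFrameThree hmod hGZ hGZK hCassels hF hr htors htors'
      (hEV W hF.1 hr hF.2.1)

/-- **Regime N ⟸ the same law** (`Theses.PrintCFram.TorsionFreeFrameBSDThree`, item
stmt-BirchSwinnertonDyer-20698; its (Av)₃ binder is not used): ONE typed residual serves N ∪ V.
[cite: Miller2011LMS, §1 and Def. 1.1 (arXiv:1010.2431 p. 3)] -/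
theorem torsionFreeFrameBSDThree_of_indexLawAtThreeV
    (hEV : ∀ (W : WeierstrassCurve ℚ) [W.IsElliptic] [W.IsGloballyMinimal],
      W.HasCM → W.analyticRank = 1 → CMRamified W 3 → RamifiedCMEllipticUnitIndexAtThreeV W) :
    Summit.BirchSwinnertonDyer.BirchSwinnertonDyer.Theses.PrintCFram.TorsionFreeFrameBSDThree :=
  fun hmod hGZ hGZK hCassels W _ _ _K _ _ _𝔭 _W' _ _ _C hF hr htors htors' _ =>
    bsdp_three_of_indexLawAtThreeV_of_isFrameThree hmod hGZ hGZK hCassels hF hr htors htors'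
      (hEV W hF.1 hr hF.2.1)

/-- **N ∧ V from the one law.** [cite: Miller2011LMS, §1 and Def. 1.1 (arXiv:1010.2431 p. 3)] -/
theorem torsionFree_and_splitPlace_of_indexLawAtThreeV
    (hEV : ∀ (W : WeierstrassCurve ℚ) [W.IsElliptic] [W.IsGloballyMinimal],
      W.HasCM → W.analyticRank = 1 → CMRamified W 3 → RamifiedCMEllipticUnitIndexAtThreeV W) :
    Summit.BirchSwinnertonDyer.BirchSwinnertonDyer.Theses.PrintCFram.TorsionFreeFrameBSDThree ∧
      Summit.BirchSwinnertonDyer.BirchSwinnertonDyer.Theses.PrintCFram.SplitPlaceTorsionBSDThree :=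
  ⟨torsionFreeFrameBSDThree_of_indexLawAtThreeV hEV, splitPlaceTorsionBSDThree_of_indexLawAtThreeV hEV⟩

/-- **C1 ⟸ (R-EU)₃ᵛ-law ∧ T**, BY NAME: with the glue of the split (`cmRamifiedThreeBSDOfRegimes_holds`,
p547523) the `@3` crux `CMRamifiedThreeBSD` follows from the defect-corrected index law on N ∪ V and
regime T (`LocalThreeTorsionBSDThree`, the `ℚ₃`-rational-`3`-torsion members — p4's records / the
printed cube-sum families). CONDITIONAL on both hypotheses; nothing booked.
[cite: Miller2011LMS, §1 and Def. 1.1 (arXiv:1010.2431 p. 3)] -/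
theorem cmRamifiedThreeBSD_of_indexLawAtThreeV_of_localThreeTorsion
    (hEV : ∀ (W : WeierstrassCurve ℚ) [W.IsElliptic] [W.IsGloballyMinimal],
      W.HasCM → W.analyticRank = 1 → CMRamified W 3 → RamifiedCMEllipticUnitIndexAtThreeV W)
    (hT : Summit.BirchSwinnertonDyer.BirchSwinnertonDyer.Theses.PrintCFram.LocalThreeTorsionBSDThree) :
    Summit.BirchSwinnertonDyer.BirchSwinnertonDyer.Theses.PrintCFram.CMRamifiedThreeBSD :=
  cmRamifiedThreeBSDOfRegimes_holds (torsionFreeFrameBSDThree_of_indexLawAtThreeV hEV) hT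
    (splitPlaceTorsionBSDThree_of_indexLawAtThreeV hEV)

end Summit.BirchSwinnertonDyer.Rank1Residual.PrintCfram

end
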